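import Mathlib.Analysis.SpecialFunctions.Exponential
import Mathlib.Analysis.Calculus.InverseFunctionTheorem.ContDiff
import Mathlib.Analysis.Calculus.ContDiff.Operations
import HarnessLib

/-!
# Smoothness along the exponential at every point is smoothness on the group of units

Topic `Analysis/Calculus`; namespace `Literature.Analysis.Calculus`. Let `𝔸` be a real Banach
algebra (in the applications `𝔸 = M_n(K_∞)`, `K_∞ = K ⊗_ℚ ℝ ≅ ℝ^{r₁} × ℂ^{r₂}`, so that
`𝔸ˣ = GL_n(K_∞)`), `exp : 𝔸 → 𝔸` the exponential (`NormedSpace.exp`) and `f : 𝔸 → F` a function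
into a real normed space. The automorphic literature defines smoothness of a function on the Lie
group `G_∞ = 𝔸ˣ` through the exponential charts: `f` is smooth iff `X ↦ f(g · exp X)` is smooth on the
Lie algebra for every `g` (Borel–Jacquet (1979), §1.1; this is the tree's `IsArchSmooth` of
`Literature.NumberTheory.Automorphic.ArchimedeanCalculus`). This file PROVES that this notion is
ordinary smoothness on the open set of units, so that derivatives of such `f` in the group variable
exist and are continuous (the input of every integration by parts in the archimedean variable, e.g.
the Schwartz estimates of Garrett (2018), §7.3, Claim 7.3.9, and Getz–Hahn (2024), Prop. 9.5.3):

* `contDiffAt_of_contDiffAt_comp_mul_exp` — if `X ↦ f(u · exp X)` is `C^m` at `0` for a unit `u`,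
  then `f` is `C^m` at `u`: near `u`, `f(y) = f(u · exp(log(u⁻¹ y)))` with `log` the local inverse
  of `exp` at `0` furnished by the inverse function theorem (`exp` is analytic with derivative `1`
  at `0`, Mathlib `hasStrictFDerivAt_exp_zero`, `ContDiffAt.to_localInverse`).
* `contDiffAt_of_forall_contDiffAt_comp_mul_exp`, `contDiffOn_of_forall_contDiff_comp_mul_exp` —
  the global forms: smoothness along `exp` at every unit gives `ContDiffAt` at every unit, i.e.
  `ContDiffOn` on the (open) set of units.
* The same with the exponential factor on the left, `X ↦ f(exp X · u)`
  (`contDiffAt_of_contDiffAt_comp_exp_mul`).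

Mathlib has the inverse function theorem and the analyticity of `exp`, but no statement relating
chart-wise smoothness along `exp` to smoothness (`lean search 'exp.*localInverse|IsArchSmooth.*ContDiffAt'`).
Folklore (Knapp, *Lie Groups Beyond an Introduction* (2002), 0.§2 and I.§10: `exp` is a local
diffeomorphism at `0` for matrix groups).
-/

noncomputable section

open NormedSpace Filter Set
open scoped Topology ContDiff

namespace Literature.Analysis.Calculus

variable {𝔸 : Type*} [NormedRing 𝔸] [NormedAlgebra ℝ 𝔸] [CompleteSpace 𝔸]
  {F : Type*} [NormedAddCommGroup F] [NormedSpace ℝ F]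

/-- `exp : 𝔸 → 𝔸` has the identity as strict derivative at `0`, in the form consumed by the inverse
function theorem (derivative a continuous linear *equivalence*). [folklore] -/
theorem hasStrictFDerivAt_exp_zero_equiv :
    HasStrictFDerivAt (exp : 𝔸 → 𝔸) ((ContinuousLinearEquiv.refl ℝ 𝔸 : 𝔸 →L[ℝ] 𝔸)) 0 := by
  have h := (hasStrictFDerivAt_exp_zero (𝕂 := ℝ) (𝔸 := 𝔸))
  convert h using 1
  ext x
  simp

/-- `exp` is analytic, hence `C^m` for every `m`, at every point. [folklore] -/
theorem contDiffAt_exp {m : WithTop ℕ∞} (x : 𝔸) : ContDiffAt ℝ m (exp : 𝔸 → 𝔸) x :=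
  (exp_analytic (𝕂 := ℝ) x).contDiffAt

/-- **A local logarithm**: the local inverse of `exp` at `0` given by the inverse function theorem.
[folklore] -/
def localLog : 𝔸 → 𝔸 :=
  (contDiffAt_exp (m := ω) (0 : 𝔸)).localInverse hasStrictFDerivAt_exp_zero_equiv.hasFDerivAt
    (by simp)

/-- `localLog 1 = 0` (`exp 0 = 1`). [folklore] -/
theorem localLog_one : localLog (1 : 𝔸) = 0 := by
  have h := (contDiffAt_exp (m := ω) (0 : 𝔸)).localInverse_apply_image
    hasStrictFDerivAt_exp_zero_equiv.hasFDerivAt (by simp)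
  rw [exp_zero] at h
  exact h

/-- `localLog` is `C^m` at `1` for every `m`. [folklore] -/
theorem contDiffAt_localLog {m : WithTop ℕ∞} : ContDiffAt ℝ m (localLog : 𝔸 → 𝔸) 1 := by
  have h := (contDiffAt_exp (m := ω) (0 : 𝔸)).to_localInverse
    hasStrictFDerivAt_exp_zero_equiv.hasFDerivAt (by simp)
  rw [exp_zero] at h
  exact h.of_le le_top

/-- `exp (localLog y) = y` for `y` near `1`. [folklore] -/
theorem eventually_exp_localLog : ∀ᶠ y in 𝓝 (1 : 𝔸), exp (localLog y) = y := by
  have h := ((contDiffAt_exp (m := ω) (0 : 𝔸)).hasStrictFDerivAt'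
    hasStrictFDerivAt_exp_zero_equiv.hasFDerivAt (by simp)).eventually_right_inverse
  rw [exp_zero] at h
  exact h

/-- **Smoothness along `exp` at a unit gives smoothness at the unit** (right charts
`X ↦ f(u · exp X)`). [folklore] -/
theorem contDiffAt_of_contDiffAt_comp_mul_exp {f : 𝔸 → F} {m : WithTop ℕ∞} (u : 𝔸ˣ)
    (h : ContDiffAt ℝ m (fun X : 𝔸 => f (↑u * exp X)) 0) : ContDiffAt ℝ m f ↑u := by
  -- the chart `y ↦ localLog (u⁻¹ y)` is smooth at `u` and sends `u` to `0`
  set L : 𝔸 → 𝔸 := fun y => ↑u⁻¹ * y with hL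
  have hLc : ContDiff ℝ m L := contDiff_const.mul contDiff_id
  have hLu : L ↑u = 1 := by simp [hL]
  have hlogL : ContDiffAt ℝ m (fun y => localLog (L y)) ↑u := by
    refine ContDiffAt.comp (↑u : 𝔸) ?_ hLc.contDiffAt
    rw [hLu]
    exact contDiffAt_localLog
  have h0 : (fun y => localLog (L y)) ↑u = 0 := by
    show localLog (L ↑u) = 0
    rw [hLu, localLog_one]
  have hcomp : ContDiffAt ℝ m ((fun X : 𝔸 => f (↑u * exp X)) ∘ fun y => localLog (L y)) ↑u := by
    have h' : ContDiffAt ℝ m (fun X : 𝔸 => f (↑u * exp X)) ((fun y => localLog (L y)) ↑u) := by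
      rw [h0]; exact h
    exact ContDiffAt.comp (↑u : 𝔸) h' hlogL
  -- and `f` agrees with the composite near `u`
  refine hcomp.congr_of_eventuallyEq ?_
  have ht : Tendsto L (𝓝 (↑u : 𝔸)) (𝓝 1) := by
    rw [← hLu]; exact hLc.continuous.continuousAt
  filter_upwards [ht.eventually eventually_exp_localLog] with y hy
  change f y = f (↑u * exp (localLog (↑u⁻¹ * y)))
  rw [show exp (localLog (↑u⁻¹ * y)) = ↑u⁻¹ * y from hy, ← mul_assoc, Units.mul_inv, one_mul]

/-- **Smoothness along `exp` at a unit gives smoothness at the unit** (left charts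
`X ↦ f(exp X · u)`). [folklore] -/
theorem contDiffAt_of_contDiffAt_comp_exp_mul {f : 𝔸 → F} {m : WithTop ℕ∞} (u : 𝔸ˣ)
    (h : ContDiffAt ℝ m (fun X : 𝔸 => f (exp X * ↑u)) 0) : ContDiffAt ℝ m f ↑u := by
  set L : 𝔸 → 𝔸 := fun y => y * ↑u⁻¹ with hL
  have hLc : ContDiff ℝ m L := contDiff_id.mul contDiff_const
  have hLu : L ↑u = 1 := by simp [hL]
  have hlogL : ContDiffAt ℝ m (fun y => localLog (L y)) ↑u := by
    refine ContDiffAt.comp (↑u : 𝔸) ?_ hLc.contDiffAt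
    rw [hLu]
    exact contDiffAt_localLog
  have h0 : (fun y => localLog (L y)) ↑u = 0 := by
    show localLog (L ↑u) = 0
    rw [hLu, localLog_one]
  have hcomp : ContDiffAt ℝ m ((fun X : 𝔸 => f (exp X * ↑u)) ∘ fun y => localLog (L y)) ↑u := by
    have h' : ContDiffAt ℝ m (fun X : 𝔸 => f (exp X * ↑u)) ((fun y => localLog (L y)) ↑u) := by
      rw [h0]; exact h
    exact ContDiffAt.comp (↑u : 𝔸) h' hlogL
  refine hcomp.congr_of_eventuallyEq ?_
  have ht : Tendsto L (𝓝 (↑u : 𝔸)) (𝓝 1) := by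
    rw [← hLu]; exact hLc.continuous.continuousAt
  filter_upwards [ht.eventually eventually_exp_localLog] with y hy
  change f y = f (exp (localLog (y * ↑u⁻¹)) * ↑u)
  rw [show exp (localLog (y * ↑u⁻¹)) = y * ↑u⁻¹ from hy, mul_assoc, Units.inv_mul, mul_one]

/-- If `X ↦ f(u · exp X)` is `C^m` at `0` for every unit `u`, then `f` is `C^m` at every unit.
[folklore] -/
theorem contDiffAt_of_forall_contDiffAt_comp_mul_exp {f : 𝔸 → F} {m : WithTop ℕ∞}
    (h : ∀ u : 𝔸ˣ, ContDiffAt ℝ m (fun X : 𝔸 => f (↑u * exp X)) 0) (u : 𝔸ˣ) :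
    ContDiffAt ℝ m f ↑u :=
  contDiffAt_of_contDiffAt_comp_mul_exp u (h u)

/-- **Chart-wise smoothness along `exp` is smoothness on the open set of units**: if
`X ↦ f(u · exp X)` is `C^m` for every unit `u` then `f` is `C^m` on `{x | IsUnit x}`.
[folklore] -/
theorem contDiffOn_of_forall_contDiff_comp_mul_exp {f : 𝔸 → F} {m : WithTop ℕ∞}
    (h : ∀ u : 𝔸ˣ, ContDiff ℝ m fun X : 𝔸 => f (↑u * exp X)) :
    ContDiffOn ℝ m f {x : 𝔸 | IsUnit x} := by
  rintro x ⟨u, rfl⟩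
  exact (contDiffAt_of_contDiffAt_comp_mul_exp u (h u).contDiffAt).contDiffWithinAt

end Literature.Analysis.Calculus
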